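import Summits.ABC.ABC.Theorems.DefiniteXiFreyModularityStubAbsIrrSqrtFiveGalois
import HarnessLib

/-!
# Crux `FreyModularity` (stmt-ABC-11340), line `Sketch`, stub `stub_absIrrSqrtFive`:
# the group-theoretic criterion

Second support file for the stub `stub_absIrrSqrtFive` (Rubin, CSS 1997, Prop. 7).

* `isAbsIrreducibleOverSqrt_five_of_mulVec_eq_self` — **the criterion used by the stub**: if
  `ρ̄ : Γ_ℚ → GL₂(𝔽₅)` is irreducible with `det ρ̄ = χ̄₅`, and some `τ₀ ∈ Γ_ℚ` has `χ̄₅(τ₀)² ≠ 1`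
  while `ρ̄(τ₀²)` fixes a non-zero vector, then `ρ̄|_{ℚ(√5)}` is absolutely irreducible.  (If
  `w₀` were a common eigenvector of `ρ̄(Γ_L)`
  (`exists_common_eigenvector_of_not_isAbsolutelyIrreducible`): `ρ̄(τ₀²) ∈ ρ̄(Γ_L)` has the
  distinct eigenvalues `1 ≠ det`, so `ρ̄(τ₀)`, commuting with it, stabilises the line `𝔽₅ w₀`;
  an element `γ` moving the line exists by irreducibility, `γ, τ₀ ∉ Γ_L`
  (`sq_modPCyclotomicCharacter_eq_one_of_mem_range`), so `τ₀⁻¹ γ ∈ Γ_L` (index `2`)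
  stabilises it — contradiction.)

Rubin's printed argument ("`ρ̄(σ)` does not square to a scalar, as it would have to if `ρ̄` were
induced from `Γ_{ℚ(√5)}`") is the same dichotomy; the arithmetic input (an inertia element at
`5` with `χ̄₅ = 2` acting through `(χ̄₅ *; 0 1)` at a place of ordinary or multiplicative
reduction, an element of order `3` at a supersingular one) is in `…StubAbsIrrSqrtFiveLocal` and
`…StubAbsIrrSqrtFive`.

## References

* [RubinCSS1997] K. Rubin, *Modularity of mod 5 representations*, in: G. Cornell,
  J. H. Silverman, G. Stevens (eds.), *Modular Forms and Fermat's Last Theorem*, Springer (1997),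
  Prop. 7 and its proof.
-/

-- `Summit.<Summit>.<Problem>` is the mandated summit-side namespace (CONVENTIONS §2); for the
-- single-conjunct summit `ABC` the two coincide, so the duplicate `ABC.ABC` is deliberate.
set_option linter.dupNamespace false

noncomputable section

open scoped MatrixGroups Polynomial

open Polynomial Matrix Field
open Literature.NumberTheory.EllipticCurves
open Literature.NumberTheory.Automorphic
open Literature.NumberTheory.Automorphic.BCDT
open Literature.NumberTheory.GaloisRepresentations
open WeierstrassCurve

namespace Summit.ABC.ABC.Theorems

/-! ## The criterion: an element outside `Γ_{ℚ(√5)}` whose square has a fixed vector -/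

/-- Over a field, the kernel of a non-zero singular `2 × 2` matrix is a line: if `N ≠ 0`,
`N w₀ = 0` with `w₀ ≠ 0` and `N u = 0`, then `u ∈ F w₀`. [folklore] -/
theorem exists_eq_smul_of_mulVec_eq_zero_of_mulVec_eq_zero {F : Type*} [Field F]
    {N : Matrix (Fin 2) (Fin 2) F} (hN0 : N ≠ 0) {w₀ u : Fin 2 → F} (hw₀ : w₀ ≠ 0)
    (hNw₀ : N *ᵥ w₀ = 0) (hNu : N *ᵥ u = 0) : ∃ c : F, u = c • w₀ := by
  set φ := N.mulVecLin with hφ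
  have hfin2 : Module.finrank F (Fin 2 → F) = 2 := by simp
  have hker1 : Module.finrank F (LinearMap.ker φ) = 1 := by
    have hsum := LinearMap.finrank_range_add_finrank_ker φ
    rw [hfin2] at hsum
    have hrange : Module.finrank F (LinearMap.range φ) ≠ 0 := by
      intro h0
      rw [Submodule.finrank_eq_zero, LinearMap.range_eq_bot] at h0
      apply hN0
      ext i j
      have hij : (N *ᵥ Pi.single j 1) i = 0 := by
        have := congrArg (fun g ↦ g (Pi.single j 1) i) h0
        simpa [hφ] using this
      rw [mulVec_single_one] at hij
      simpa using hij
    have hkerpos : Module.finrank F (LinearMap.ker φ) ≠ 0 := by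
      intro h0
      rw [Submodule.finrank_eq_zero] at h0
      have : w₀ ∈ LinearMap.ker φ := by rw [LinearMap.mem_ker, hφ, mulVecLin_apply, hNw₀]
      rw [h0, Submodule.mem_bot] at this
      exact hw₀ this
    omega
  have hker : LinearMap.ker φ = F ∙ w₀ := by
    have hwmem : w₀ ∈ LinearMap.ker φ := by rw [LinearMap.mem_ker, hφ, mulVecLin_apply, hNw₀]
    refine (Submodule.eq_of_le_of_finrank_eq
      ((Submodule.span_singleton_le_iff_mem w₀ _).mpr hwmem) ?_).symm
    rw [finrank_span_singleton hw₀, hker1]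
  have hu : u ∈ LinearMap.ker φ := by rw [LinearMap.mem_ker, hφ, mulVecLin_apply, hNu]
  rw [hker, Submodule.mem_span_singleton] at hu
  obtain ⟨c, hc⟩ := hu
  exact ⟨c, hc.symm⟩

/-- **Absolute irreducibility over `ℚ(√5)` from one element** (the group-theoretic half of
Rubin, CSS 1997, Prop. 7, in the form used by the stub).  Let `ρ̄ : Γ_ℚ → GL₂(𝔽₅)` be continuous
and irreducible with `det ρ̄ = χ̄₅`, and let `τ₀ ∈ Γ_ℚ` have `χ̄₅(τ₀)² ≠ 1` (so `τ₀ ∉ Γ_{ℚ(√5)}`)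
while `ρ̄(τ₀²)` fixes a non-zero vector.  Then `ρ̄|_{ℚ(√5)}` is absolutely irreducible.
Proof: otherwise `ρ̄(Γ_L)` has a common rational eigenvector `w₀`
(`exists_common_eigenvector_of_not_isAbsolutelyIrreducible`); `M = ρ̄(τ₀²) ∈ ρ̄(Γ_L)` (squares lie
in `Γ_L`) has `w₀` as an eigenvector and the two distinct eigenvalues `1 ≠ det M = χ̄₅(τ₀)²`, so
its eigenlines are lines and `ρ̄(τ₀)`, which commutes with `M`, stabilises `𝔽₅ w₀`; by
irreducibility some `γ ∈ Γ_ℚ` moves `𝔽₅ w₀`, so `γ ∉ Γ_L`, and `τ₀ ∉ Γ_L`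
(`sq_modPCyclotomicCharacter_eq_one_of_mem_range`), whence `τ₀⁻¹ γ ∈ Γ_L` (index `2`) and
`γ = τ₀ (τ₀⁻¹ γ)` stabilises `𝔽₅ w₀` — a contradiction. [cite: RubinCSS1997, Prop. 7] -/
theorem isAbsIrreducibleOverSqrt_five_of_mulVec_eq_self (ρ : ModPGaloisRep ℚ (ZMod 5) 2)
    (hdet : ∀ σ : absoluteGaloisGroup ℚ,
      Matrix.GeneralLinearGroup.det (ρ σ) = modPCyclotomicCharacterZMod ℚ 5 σ)
    (hirr : FramedRep.IsIrreducible ρ) {τ₀ : absoluteGaloisGroup ℚ}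
    (hτ₀ : modPCyclotomicCharacterZMod ℚ 5 τ₀ ^ 2 ≠ 1) {v₁ : Fin 2 → ZMod 5} (hv₁ : v₁ ≠ 0)
    (hfix : ((ρ (τ₀ * τ₀) : GL (Fin 2) (ZMod 5)) : Matrix (Fin 2) (Fin 2) (ZMod 5)) *ᵥ v₁ = v₁) :
    ρ.IsAbsIrreducibleOverSqrt 5 := by
  intro L _ _ _
  classical
  by_contra hnot
  obtain ⟨w₀, hw₀, heig₀⟩ :=
    exists_common_eigenvector_of_not_isAbsolutelyIrreducible L ρ hdet hnot
  haveI : FiniteDimensional ℚ L := IsSplittingField.finiteDimensional L (X ^ 2 - C (5 : ℚ))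
  -- the matrices `A g = ρ̄(g)`
  set A : absoluteGaloisGroup ℚ → Matrix (Fin 2) (Fin 2) (ZMod 5) :=
    fun g ↦ ((ρ g : GL (Fin 2) (ZMod 5)) : Matrix (Fin 2) (Fin 2) (ZMod 5)) with hA
  have hAmul : ∀ g h, A (g * h) = A g * A h := fun g h ↦ by
    simp only [hA, map_mul, Units.val_mul]
  -- `M = ρ̄(τ₀²)`: fixes `v₁`, `det M ≠ 1`
  set M := A (τ₀ * τ₀) with hM
  have hMv₁ : M *ᵥ v₁ = v₁ := hfix
  have hdetM : M.det ≠ 1 := by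
    intro h1
    apply hτ₀
    have h2 := congrArg (fun u : (ZMod 5)ˣ ↦ (u : ZMod 5)) (hdet (τ₀ * τ₀))
    simp only [Matrix.GeneralLinearGroup.val_det_apply] at h2
    ext
    rw [Units.val_pow_eq_pow_val, pow_two, ← Units.val_mul, ← map_mul, ← h2, Units.val_one]
    exact h1
  -- `w₀` is an eigenvector of `M` (`τ₀² ∈ Γ_L`)
  obtain ⟨g₁, hg₁⟩ := sq_mem_range_absGaloisRestrict L τ₀
  obtain ⟨ν, hν⟩ := heig₀ g₁
  have hMw₀ : M *ᵥ w₀ = ν • w₀ := by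
    have h1 := hν
    rw [hg₁, pow_two] at h1
    exact h1
  -- `u = ρ̄(τ₀) w₀` is again a `ν`-eigenvector of `M`
  have hcomm : M * A τ₀ = A τ₀ * M := by rw [hM, ← hAmul, ← hAmul, mul_assoc]
  have hMu : M *ᵥ (A τ₀ *ᵥ w₀) = ν • (A τ₀ *ᵥ w₀) := by
    rw [mulVec_mulVec, hcomm, ← mulVec_mulVec, hMw₀, mulVec_smul]
  -- `N = M - ν` is non-zero and kills `w₀` and `u`, so `u ∈ 𝔽₅ w₀`
  set N : Matrix (Fin 2) (Fin 2) (ZMod 5) := M - ν • (1 : Matrix (Fin 2) (Fin 2) (ZMod 5)) with hN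
  have hNw₀ : N *ᵥ w₀ = 0 := by rw [hN, sub_mulVec, smul_mulVec, one_mulVec, hMw₀, sub_self]
  have hNu : N *ᵥ (A τ₀ *ᵥ w₀) = 0 := by
    rw [hN, sub_mulVec, smul_mulVec, one_mulVec, hMu, sub_self]
  have hN0 : N ≠ 0 := by
    intro h0
    have hMeq : M = ν • (1 : Matrix (Fin 2) (Fin 2) (ZMod 5)) := sub_eq_zero.mp (hN ▸ h0)
    have hν1 : ν = 1 := by
      have h1 : ν • v₁ = v₁ := by
        have h2 := hMv₁
        rwa [hMeq, smul_mulVec, one_mulVec] at h2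
      have h2 : (ν - 1) • v₁ = 0 := by rw [sub_smul, one_smul, h1, sub_self]
      rcases smul_eq_zero.mp h2 with h | h
      · exact sub_eq_zero.mp h
      · exact absurd h hv₁
    apply hdetM
    rw [hMeq, hν1, one_smul, Matrix.det_one]
  obtain ⟨c, hc⟩ := exists_eq_smul_of_mulVec_eq_zero_of_mulVec_eq_zero hN0 hw₀ hNw₀ hNu
  -- irreducibility over `𝔽₅`: some `γ` moves the line `𝔽₅ w₀`
  obtain ⟨γ, hγ⟩ : ∃ γ : absoluteGaloisGroup ℚ, A γ *ᵥ w₀ ∉ (ZMod 5) ∙ w₀ := by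
    by_contra hall
    push Not at hall
    let S : Subrepresentation (FramedRep.toRepresentation ρ) :=
      { toSubmodule := (ZMod 5) ∙ w₀
        apply_mem_toSubmodule := fun g v hv ↦ by
          rw [Submodule.mem_span_singleton] at hv
          obtain ⟨a, rfl⟩ := hv
          rw [FramedRep.toRepresentation_apply_apply, mulVec_smul]
          exact Submodule.smul_mem _ a (hall g) }
    rcases hirr.eq_bot_or_eq_top S with h | h
    · have h' : (ZMod 5) ∙ w₀ = ⊥ := congrArg Subrepresentation.toSubmodule h
      exact hw₀ (Submodule.span_singleton_eq_bot.mp h')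
    · have h' : (ZMod 5) ∙ w₀ = ⊤ := congrArg Subrepresentation.toSubmodule h
      have h1 := finrank_span_singleton (K := ZMod 5) hw₀
      rw [h', finrank_top] at h1
      simp at h1
  have hγrange : γ ∉ Set.range (absGaloisRestrict ℚ L) := by
    rintro ⟨g, hg⟩
    obtain ⟨ν', hν'⟩ := heig₀ g
    rw [hg] at hν'
    exact hγ (Submodule.mem_span_singleton.mpr ⟨ν', hν'.symm⟩)
  have hτ₀range : τ₀ ∉ Set.range (absGaloisRestrict ℚ L) := fun hmem ↦
    hτ₀ (sq_modPCyclotomicCharacter_eq_one_of_mem_range L hmem)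
  obtain ⟨g₂, hg₂⟩ :=
    inv_mul_mem_range_absGaloisRestrict (finrank_eq_two_of_isSplittingField L) hτ₀range hγrange
  obtain ⟨ν₂, hν₂⟩ := heig₀ g₂
  rw [hg₂] at hν₂
  refine hγ ?_
  have hAγ : A γ = A τ₀ * A (τ₀⁻¹ * γ) := by rw [← hAmul, mul_inv_cancel_left]
  rw [hAγ, ← mulVec_mulVec, hν₂, mulVec_smul, hc, smul_smul]
  exact Submodule.mem_span_singleton.mpr ⟨ν₂ * c, rfl⟩


/-- **Registered helper stub (group-theoretic criterion) toward `stub_absIrrSqrtFive`**: the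
arrow form of `isAbsIrreducibleOverSqrt_five_of_mulVec_eq_self` — `ρ̄` irreducible with
`det ρ̄ = χ̄₅`, `χ̄₅(τ₀)² ≠ 1` and `ρ̄(τ₀²) v₁ = v₁ ≠ 0` imply `ρ̄|_{ℚ(√5)}` absolutely irreducible.
[cite: RubinCSS1997, Prop. 7] -/
theorem stub_absIrrSqrtFive_group :
    ∀ (ρ : ModPGaloisRep ℚ (ZMod 5) 2),
      (∀ σ : absoluteGaloisGroup ℚ,
        Matrix.GeneralLinearGroup.det (ρ σ) = modPCyclotomicCharacterZMod ℚ 5 σ) →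
      FramedRep.IsIrreducible ρ → ∀ (τ₀ : absoluteGaloisGroup ℚ),
      modPCyclotomicCharacterZMod ℚ 5 τ₀ ^ 2 ≠ 1 → ∀ (v₁ : Fin 2 → ZMod 5), v₁ ≠ 0 →
      ((ρ (τ₀ * τ₀) : GL (Fin 2) (ZMod 5)) : Matrix (Fin 2) (Fin 2) (ZMod 5)) *ᵥ v₁ = v₁ →
      ρ.IsAbsIrreducibleOverSqrt 5 := by
  intro ρ hdet hirr τ₀ hτ₀ v₁ hv₁ hfix
  exact isAbsIrreducibleOverSqrt_five_of_mulVec_eq_self ρ hdet hirr hτ₀ hv₁ hfix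

end Summit.ABC.ABC.Theorems

end
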